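import Summits.BirchSwinnertonDyer.BirchSwinnertonDyer.Theorems.ClassRecordThreeEulerHalvesAtThreeCartanTorusCubeCutCyclic
import HarnessLib

/-!
# Crux 19109 `EulerHalvesAtThree` ∕ 23422 line `cartan` v8′, stub (F2a): the TORUS-CUBE CUT of S-K1′ — S-K1′ on `q ≥ 5`
# (`CartanDegree.CubicTorusPeriodRatioAtThreeGeFive`) REDUCED to five finite-group statements — file 3/3: the inputs, the two cases, the composition

Seat `bsd-idea-10` g11 (planner-bsd-idea-10-g11-0, D-0145 ideator; `--supports stmt-BirchSwinnertonDyer-19109 --as helper`). CONTENT = §§4–6 of the sorry-free part of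
the unregistered workfile `Cruxes/EulerHalvesAtThree/Lines/cartan_sk1.lean` (commit bc8966080569), as to the proofs verbatim. Around it, ALREADY IN THE TREE: file 1/3
`…CartanTorusCubeCutFrame` (p680737: the norm operators `N_S = Σ_{t∈S} ρ(t)` of the split torus `T_s`, the non-split torus `T_C` (centraliser of `η`) and its cubes `T_C³`
acting on a `CartanTorusLattice q`; their fixedness; the PAIRING LEMMA `A·B(w_S,w_S)·|T| = b·B(w_C,w_C)·|T_s|` for the coefficients `N_{T_s}(ρ(g)w_C) = A·w_S`,
`N_T(ρ(g)⁻¹w_S) = b·w_C` (from `B_inv` alone); the RANK-ONE TRACE IDENTITY `Σ_{s∈T_s,t∈T} χ_W(s g t g⁻¹) = tr(N_{T_s} ρ(g) N_T ρ(g)⁻¹) = A·b`; 3-adic bookkeeping);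
file 2/3 `…CartanTorusCubeCutTori` (p681375: `|T_s| = (q−1)²`, `|T_C| = (q−1)(q+1)`); `…CartanTorusCubeCutCyclic` (tam3-p1 g21, p682001: `T_C` cyclic, the cube index
`nonsplitCubes_card : 3·|T_C³| = (q−1)(q+1)` — so the former input (T) `P_torusCard` of the workfile is a THEOREM and is no longer a hypothesis here); `…CartanTorusCubeCutCentre`
(p682009: LEMMA Z, the centre acts trivially, `rho_eq_one_of_isScalarMat`). HERE: the CUSPIDAL CASE (`q ≡ 2 (3)`, `cusp_case`) and the PRINCIPAL-SERIES CASE (`q ≡ 1 (3)`,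
`ps_case`), and the composition
`cubicTorusPeriodRatioAtThreeGeFive_of : P_cuspCubeNormFixed → P_cuspGoodConjugate → P_psNonsplitNormLower → P_psSplitNormSharp → P_psNonsplitNormSharp →
CubicTorusPeriodRatioAtThreeGeFive` (the tree decl of `…CartanDegreeDefs`, BY NAME). The five inputs are the `@[conjecture]`-tagged named `Prop`s (C1), (C2), (P1), (P2), (P3)
below — finite statements about `GL₂(𝔽_q)` acting on one integral lattice (cusp: cube norms are torus-fixed, and some conjugate has `3 ∤ S₃(g)`; PS: three 3-divisibility
bounds on torus norms), each numerically confirmed at q = 5, 7, 11, 13, 17, 19, 23, 37 (card `Cruxes/EulerHalvesAtThree/Lines/cartan_sk1.md`). PURPOSE (RULING 91(b)): provers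
import this file, prove the five `P_*` as ordinary Theorems helpers (division of labour on the cell bus: tam3-p1 lineage (C1), (C2); cartan-f2a lineage (P1)–(P3)), and close
the registered v8′ stub `stub_cubicTorusPeriodRatioAtThreeGeFive` BY NAME through `cubicTorusPeriodRatioAtThreeGeFive_of`.
HONEST FRAMING: theorems only; `cubicTorusPeriodRatioAtThreeGeFive_of` is CONDITIONAL on its five displayed hypotheses, none of which is proved here; S-K1′ is NOT
proved; no summit statement, no route item and no registered stub is proved; BSD is proved for no curve. References: [cite: Bump1997, §4.1 (GL(2) over a finite
field)] for the character theory behind (C1), (C2); the modular inputs of (P1), (P3) (3-modular Steinberg module) are named in the docstrings, not used.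
-- adapted from Summits/BirchSwinnertonDyer/BirchSwinnertonDyer/Cruxes/EulerHalvesAtThree/Lines/cartan_sk1.lean (bsd-idea-10 g11), §§4–6 (the `stub_*` block omitted: its statements are the `@[conjecture]` inputs; (T) now a theorem)
-/

namespace Summit.BirchSwinnertonDyer.BirchSwinnertonDyer.Theorems.CartanTorusCubeCut

open Summit.BirchSwinnertonDyer.BirchSwinnertonDyer.Theorems.CartanDegree

set_option linter.dupNamespace false
set_option linter.unusedSectionVars false
set_option autoImplicit false

variable {q : ℕ} [Fact q.Prime]

/-! ### The five inputs (named `Prop`s, `@[conjecture]`-tagged = not proved here; each a finite-group / integral-representation lemma; the former sixth, (T), is the theorem `nonsplitCubes_card` of `…CartanTorusCubeCutCyclic` + `splitTorus_card`, `nonsplitTorus_card` of `…CartanTorusCubeCutTori`) -/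

/-- (C1) CUSPIDAL CASE, CUBE NORMS: for `q ≡ 2 (3)` the norm `N_{T_C³} x` of any lattice vector is fixed by the whole
non-split torus — i.e. `X^{T_C³} = X^{T_C}` (character count: `Σ_{t ∈ T_C³} χ_W(t) = |T_C³|`, because `Z ⊂ T_C³`
(`χ = q−1`) and non-scalar cubes have `χ = −2`; so the `T_C³`-fixed space of `W` is the line `W^{T_C}`). -/
@[conjecture]
def P_cuspCubeNormFixed : Prop :=
  ∀ (q : ℕ) [Fact q.Prime], 5 ≤ q → q % 3 = 2 →
    ∀ (𝓛 : CartanTorusLattice q) (x : Fin 𝓛.d → ℤ), 𝓛.IsNonsplitFixed (normOp 𝓛 (nonsplitCubes 𝓛.η) x)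

/-- (C2) CUSPIDAL CASE, A GOOD CONJUGATE: for `q ≡ 2 (3)` some `g` has `3 ∤ S₃(g) = Σ_{s ∈ T_s, t ∈ T_C³} χ_W(s g t g⁻¹)`
(pure finite-field counting: `χ_W ≡ 1 + #Fix_{P¹(𝔽_q)}` `(mod 3)`; `T̄′ = g T̄_C g⁻¹` acts simply transitively on `P¹`,
`T̄′³` has three orbits; `S₃ ≢ 0 (3)` iff `0` and `∞` lie in different `T̄′³`-orbits; take `g` moving `T_C` to the
centraliser of `(a 1; −n 0)`, `x² − a x + n` the minimal polynomial of a non-cube of `𝔽_{q²}^×`). Decidable for each `q`. -/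
@[conjecture]
def P_cuspGoodConjugate : Prop :=
  ∀ (q : ℕ) [Fact q.Prime], 5 ≤ q → q % 3 = 2 →
    ∀ (η : Mat q), ¬ HasRatEigenvalue η → ∃ g : G q, ¬ (3 : ℤ) ∣ S3 q η g

/-- (P1) PRINCIPAL-SERIES CASE, LOWER BOUND: for `q ≡ 1 (3)` every non-split norm of a translate of `w_S` is divisible by
`3^{ord₃(q−1)+1}` along `w_C` (the centre `Z`, `|Z| = q − 1`, acts trivially — PROVED: `rho_eq_one_of_isScalarMat` of `…CartanTorusCubeCutCentre`; and mod `3` there is a `G`-invariant functional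
`λ` with `λ(w_S) = 0 ≠ λ(w_C)` — from `(X/3X)^G = 0` = `noFixedVectorModThree` and the structure
`X/3X ≅ 𝔽₃[P¹(𝔽_q)]/𝟙` — so `N_{T̄_C}` kills the image of `⟨G·w_S⟩` in the `T̄_C`-coinvariants mod `3`). -/
@[conjecture]
def P_psNonsplitNormLower : Prop :=
  ∀ (q : ℕ) [Fact q.Prime], 5 ≤ q → q % 3 = 1 →
    ∀ (𝓛 : CartanTorusLattice q) (wS wC : Fin 𝓛.d → ℤ),
    𝓛.IsSplitFixed wS → (∀ v, 𝓛.IsSplitFixed v → ∃ m : ℤ, v = m • wS) →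
    𝓛.IsNonsplitFixed wC → (∀ v, 𝓛.IsNonsplitFixed v → ∃ m : ℤ, v = m • wC) →
    ∀ (g : G q) (m : ℤ), normOp 𝓛 (nonsplitTorus 𝓛.η) (𝓛.ρ g wS) = m • wC →
      (3 : ℤ) ^ (padicValNat 3 (q - 1) + 1) ∣ m

/-- (P2) PRINCIPAL-SERIES CASE, A SHARP SPLIT NORM: for `q ≡ 1 (3)` some split norm of a translate of `w_C` is NOT divisible
by `3^{ord₃(q−1)+1}` along `w_S` (`⟨G·w_C⟩ = X` because `w_C ∉` the unique maximal submodule mod `3`, and the `D`-norm,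
`D = {diag(a,1)}`, is onto `ℤ₃·w_S` since `X ⊗ 𝔽̄₃ ⊖ (fixed line) ≅ 𝔽̄₃[D]` as a `D`-module). Uses `noFixedVectorModThree`. -/
@[conjecture]
def P_psSplitNormSharp : Prop :=
  ∀ (q : ℕ) [Fact q.Prime], 5 ≤ q → q % 3 = 1 →
    ∀ (𝓛 : CartanTorusLattice q) (wS wC : Fin 𝓛.d → ℤ),
    𝓛.IsSplitFixed wS → (∀ v, 𝓛.IsSplitFixed v → ∃ m : ℤ, v = m • wS) →
    𝓛.IsNonsplitFixed wC → (∀ v, 𝓛.IsNonsplitFixed v → ∃ m : ℤ, v = m • wC) →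
    ∃ g : G q, ∀ m : ℤ, normOp 𝓛 (splitTorus q) (𝓛.ρ g wC) = m • wS →
      ¬ (3 : ℤ) ^ (padicValNat 3 (q - 1) + 1) ∣ m

/-- (P3) PRINCIPAL-SERIES CASE, A SHARP NON-SPLIT NORM: for `q ≡ 1 (3)` some `g` has its non-split norm of `ρ(g)⁻¹ w_S`
NOT divisible by `3^{ord₃(q−1)+2}` along `w_C` (non-splitness of `ker λ / 3·ker λ` as an extension of `𝟙` by the
simple module `I/3X`: a splitting would produce a `G`-sublattice reducing to a `(q−1)`-dimensional submodule of `X/3X`, which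
has none), while the split norm of `ρ(g) w_C` is divisible by `3^{ord₃(q−1)}` (the centre acts trivially: `rho_eq_one_of_isScalarMat` of `…CartanTorusCubeCutCentre`, proved). -/
@[conjecture]
def P_psNonsplitNormSharp : Prop :=
  ∀ (q : ℕ) [Fact q.Prime], 5 ≤ q → q % 3 = 1 →
    ∀ (𝓛 : CartanTorusLattice q) (wS wC : Fin 𝓛.d → ℤ),
    𝓛.IsSplitFixed wS → (∀ v, 𝓛.IsSplitFixed v → ∃ m : ℤ, v = m • wS) →
    𝓛.IsNonsplitFixed wC → (∀ v, 𝓛.IsNonsplitFixed v → ∃ m : ℤ, v = m • wC) →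
    ∃ g : G q, (∀ m : ℤ, normOp 𝓛 (nonsplitTorus 𝓛.η) (𝓛.ρ g⁻¹ wS) = m • wC →
        ¬ (3 : ℤ) ^ (padicValNat 3 (q - 1) + 2) ∣ m) ∧
      (∀ m : ℤ, normOp 𝓛 (splitTorus q) (𝓛.ρ g wC) = m • wS → (3 : ℤ) ^ padicValNat 3 (q - 1) ∣ m)

/-! ### The two cases (sorry-free; the inputs enter as hypotheses) -/

section Cases
variable (𝓛 : CartanTorusLattice q) {wS wC : Fin 𝓛.d → ℤ}

/-- CUSPIDAL CASE `q ≡ 2 (3)`: S-K1′ from (T), (C1), (C2) — the torus-cube cut. -/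
theorem cusp_case (hq5 : 5 ≤ q) (hS : 𝓛.IsSplitFixed wS) (hSgen : ∀ v, 𝓛.IsSplitFixed v → ∃ m : ℤ, v = m • wS)
    (hC : 𝓛.IsNonsplitFixed wC) (hCgen : ∀ v, 𝓛.IsNonsplitFixed v → ∃ m : ℤ, v = m • wC)
    (hcardS : (splitTorus q).card = (q - 1) ^ 2) (hcard3 : 3 * (nonsplitCubes 𝓛.η).card = (q - 1) * (q + 1))
    (hfix : ∀ x, 𝓛.IsNonsplitFixed (normOp 𝓛 (nonsplitCubes 𝓛.η) x))
    (hgood : ∃ g : G q, ¬ (3 : ℤ) ∣ S3 q 𝓛.η g) :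
    padicValInt 3 (𝓛.B wS wS) + padicValNat 3 (q + 1) =
      padicValInt 3 (𝓛.B wC wC) + 1 + padicValNat 3 (q - 1) := by
  obtain ⟨g, hg⟩ := hgood
  have hNs : ∀ y, ∃ m : ℤ, normOp 𝓛 (splitTorus q) y = m • wS := fun y => hSgen _ (isSplitFixed_normOp 𝓛 y)
  have hN3 : ∀ y, ∃ m : ℤ, normOp 𝓛 (nonsplitCubes 𝓛.η) y = m • wC := fun y => hCgen _ (hfix y)
  have hS3 : S3 q 𝓛.η g = LinearMap.trace ℤ _
      (normOp 𝓛 (splitTorus q) * (𝓛.ρ g * normOp 𝓛 (nonsplitCubes 𝓛.η) * 𝓛.ρ g⁻¹)) :=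
    sum_sum_char_eq_trace 𝓛 (splitTorus q) (nonsplitCubes 𝓛.η) g
  -- the generators are non-zero (else the operator, hence `S₃(g)`, vanishes)
  have hwS : wS ≠ 0 := by
    rintro rfl
    apply hg
    have h0 : normOp 𝓛 (splitTorus q) = 0 := by
      apply LinearMap.ext; intro y; obtain ⟨m, hm⟩ := hNs y; simpa using hm
    rw [hS3, h0, zero_mul, map_zero]
    exact dvd_zero 3
  have hwC : wC ≠ 0 := by
    rintro rfl
    apply hg
    have h0 : normOp 𝓛 (nonsplitCubes 𝓛.η) = 0 := by
      apply LinearMap.ext; intro y; obtain ⟨m, hm⟩ := hN3 y; simpa using hm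
    rw [hS3, h0, mul_zero, zero_mul, mul_zero, map_zero]
    exact dvd_zero 3
  -- the coefficients `A`, `b`
  obtain ⟨A, hA⟩ := hNs (𝓛.ρ g wC)
  let c := coeffAlong 𝓛 (normOp 𝓛 (nonsplitCubes 𝓛.η)) wC hN3 hwC
  have hc : ∀ x, normOp 𝓛 (nonsplitCubes 𝓛.η) x = c x • wC :=
    coeffAlong_spec 𝓛 (normOp 𝓛 (nonsplitCubes 𝓛.η)) wC hN3 hwC
  obtain ⟨b, hb_def⟩ : ∃ b : ℤ, b = c (𝓛.ρ g⁻¹ wS) := ⟨_, rfl⟩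
  have hb : normOp 𝓛 (nonsplitCubes 𝓛.η) (𝓛.ρ g⁻¹ wS) = b • wC := by rw [hb_def]; exact hc _
  -- (c4): `S₃(g) = A·b`
  have hAb : S3 q 𝓛.η g = A * b := by rw [hS3, trace_normOp_conj 𝓛 g A hA c hc, hb_def]
  have hA3 : ¬ (3 : ℤ) ∣ A := fun h => hg (hAb ▸ h.mul_right b)
  have hb3 : ¬ (3 : ℤ) ∣ b := fun h => hg (hAb ▸ h.mul_left A)
  have hA0 : A ≠ 0 := by rintro rfl; exact hA3 (dvd_zero 3)
  have hb0 : b ≠ 0 := by intro h0; rw [h0] at hb3; exact hb3 (dvd_zero 3)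
  -- (c3): the pairing identity
  obtain ⟨-, -, hE⟩ := pairing 𝓛 hS (nonsplitCubes_fix 𝓛 hC) g A b hA hb
  -- valuations
  have hBss : 𝓛.B wS wS ≠ 0 := (𝓛.B_pos wS hwS).ne'
  have hBcc : 𝓛.B wC wC ≠ 0 := (𝓛.B_pos wC hwC).ne'
  have hq1 : q - 1 ≠ 0 := by omega
  have hT3pos : (nonsplitCubes 𝓛.η).card ≠ 0 := by
    intro h; rw [h] at hcard3; simp at hcard3; omega
  have hTspos : (splitTorus q).card ≠ 0 := by rw [hcardS]; positivity
  have hv := congrArg (padicValInt 3) hE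
  rw [padicValInt.mul (mul_ne_zero hA0 hBss) (by exact_mod_cast hT3pos),
    padicValInt.mul hA0 hBss, padicValInt.mul (mul_ne_zero hb0 hBcc) (by exact_mod_cast hTspos),
    padicValInt.mul hb0 hBcc, padicValInt.of_nat, padicValInt.of_nat,
    padicValInt_eq_zero_of_not_three_dvd hA3, padicValInt_eq_zero_of_not_three_dvd hb3] at hv
  have hvS : padicValNat 3 (splitTorus q).card = 2 * padicValNat 3 (q - 1) := by
    rw [hcardS, padicValNat.pow]
  have hv3 : 1 + padicValNat 3 (nonsplitCubes 𝓛.η).card = padicValNat 3 (q - 1) + padicValNat 3 (q + 1) := by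
    have := congrArg (padicValNat 3) hcard3
    rwa [padicValNat.mul (by norm_num) hT3pos, padicValNat.mul hq1 (by omega), padicValNat_self] at this
  omega

/-- PRINCIPAL-SERIES CASE `q ≡ 1 (3)`: S-K1′ from (T), (P1), (P2), (P3). -/
theorem ps_case (hq5 : 5 ≤ q) (hS : 𝓛.IsSplitFixed wS) (hSgen : ∀ v, 𝓛.IsSplitFixed v → ∃ m : ℤ, v = m • wS)
    (hC : 𝓛.IsNonsplitFixed wC) (hCgen : ∀ v, 𝓛.IsNonsplitFixed v → ∃ m : ℤ, v = m • wC)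
    (hcardS : (splitTorus q).card = (q - 1) ^ 2) (hcardC : (nonsplitTorus 𝓛.η).card = (q - 1) * (q + 1))
    (hP1 : ∀ (g : G q) (m : ℤ), normOp 𝓛 (nonsplitTorus 𝓛.η) (𝓛.ρ g wS) = m • wC →
      (3 : ℤ) ^ (padicValNat 3 (q - 1) + 1) ∣ m)
    (hP2 : ∃ g : G q, ∀ m : ℤ, normOp 𝓛 (splitTorus q) (𝓛.ρ g wC) = m • wS →
      ¬ (3 : ℤ) ^ (padicValNat 3 (q - 1) + 1) ∣ m)
    (hP3 : ∃ g : G q, (∀ m : ℤ, normOp 𝓛 (nonsplitTorus 𝓛.η) (𝓛.ρ g⁻¹ wS) = m • wC →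
        ¬ (3 : ℤ) ^ (padicValNat 3 (q - 1) + 2) ∣ m) ∧
      (∀ m : ℤ, normOp 𝓛 (splitTorus q) (𝓛.ρ g wC) = m • wS → (3 : ℤ) ^ padicValNat 3 (q - 1) ∣ m)) :
    padicValInt 3 (𝓛.B wS wS) + padicValNat 3 (q + 1) =
      padicValInt 3 (𝓛.B wC wC) + 1 + padicValNat 3 (q - 1) := by
  have hNs : ∀ y, ∃ m : ℤ, normOp 𝓛 (splitTorus q) y = m • wS :=
    fun y => hSgen _ (isSplitFixed_normOp 𝓛 y)
  have hNC : ∀ y, ∃ m : ℤ, normOp 𝓛 (nonsplitTorus 𝓛.η) y = m • wC :=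
    fun y => hCgen _ (isNonsplitFixed_normOp 𝓛 y)
  obtain ⟨g₂, hg₂⟩ := hP2
  obtain ⟨g₁, hg₁C, hg₁S⟩ := hP3
  -- non-vanishing of the generators
  have hwS : wS ≠ 0 := by
    rintro rfl
    obtain ⟨m, hm⟩ := hNs (𝓛.ρ g₂ wC)
    have h0 : normOp 𝓛 (splitTorus q) (𝓛.ρ g₂ wC) = (0 : ℤ) • (0 : Fin 𝓛.d → ℤ) := by
      rw [hm, smul_zero, smul_zero]
    exact (ne_zero_and_padicValInt_le_of_not_dvd (hg₂ 0 h0)).1 rfl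
  have hwC : wC ≠ 0 := by
    rintro rfl
    obtain ⟨m, hm⟩ := hNC (𝓛.ρ g₁⁻¹ wS)
    have h0 : normOp 𝓛 (nonsplitTorus 𝓛.η) (𝓛.ρ g₁⁻¹ wS) = (0 : ℤ) • (0 : Fin 𝓛.d → ℤ) := by
      rw [hm, smul_zero, smul_zero]
    exact (ne_zero_and_padicValInt_le_of_not_dvd (hg₁C 0 h0)).1 rfl
  have hBss : 𝓛.B wS wS ≠ 0 := (𝓛.B_pos wS hwS).ne'
  have hBcc : 𝓛.B wC wC ≠ 0 := (𝓛.B_pos wC hwC).ne'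
  have hBss_pos : 0 < 𝓛.B wS wS := 𝓛.B_pos wS hwS
  have hBcc_pos : 0 < 𝓛.B wC wC := 𝓛.B_pos wC hwC
  have hq1 : q - 1 ≠ 0 := by omega
  have hTspos : (splitTorus q).card ≠ 0 := by rw [hcardS]; positivity
  have hTCpos : (nonsplitTorus 𝓛.η).card ≠ 0 := by rw [hcardC]; positivity
  have hvS : padicValNat 3 (splitTorus q).card = 2 * padicValNat 3 (q - 1) := by rw [hcardS, padicValNat.pow]
  have hvC : padicValNat 3 (nonsplitTorus 𝓛.η).card = padicValNat 3 (q - 1) + padicValNat 3 (q + 1) := by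
    rw [hcardC, padicValNat.mul hq1 (by omega)]
  -- at `g₂`: `ord₃ A₂ ≤ v`, `ord₃ b₂ ≥ v + 1`
  obtain ⟨A₂, hA₂⟩ := hNs (𝓛.ρ g₂ wC)
  obtain ⟨b₂, hb₂⟩ := hNC (𝓛.ρ g₂⁻¹ wS)
  obtain ⟨hA₂0, hA₂v⟩ := ne_zero_and_padicValInt_le_of_not_dvd (hg₂ A₂ hA₂)
  obtain ⟨h1₂, h2₂, hE₂⟩ := pairing 𝓛 hS (nonsplitTorus_fix 𝓛 hC) g₂ A₂ b₂ hA₂ hb₂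
  have hβ₂ : 𝓛.B (𝓛.ρ g₂ wC) wS ≠ 0 := by
    intro h0; rw [h0, mul_zero] at h1₂; exact mul_ne_zero hA₂0 hBss h1₂
  have hb₂0 : b₂ ≠ 0 := by
    intro h0; rw [h0, zero_mul] at h2₂
    exact mul_ne_zero (by exact_mod_cast hTCpos) hβ₂ h2₂.symm
  have hb₂v : padicValNat 3 (q - 1) + 1 ≤ padicValInt 3 b₂ := le_padicValInt_of_dvd hb₂0 (hP1 g₂⁻¹ b₂ hb₂)
  have hv₂ := congrArg (padicValInt 3) hE₂
  rw [padicValInt.mul (mul_ne_zero hA₂0 hBss) (by exact_mod_cast hTCpos),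
    padicValInt.mul hA₂0 hBss, padicValInt.mul (mul_ne_zero hb₂0 hBcc) (by exact_mod_cast hTspos),
    padicValInt.mul hb₂0 hBcc, padicValInt.of_nat, padicValInt.of_nat] at hv₂
  -- at `g₁`: `ord₃ b₁ ≤ v + 1`, `ord₃ A₁ ≥ v`
  obtain ⟨A₁, hA₁⟩ := hNs (𝓛.ρ g₁ wC)
  obtain ⟨b₁, hb₁⟩ := hNC (𝓛.ρ g₁⁻¹ wS)
  obtain ⟨hb₁0, hb₁v⟩ := ne_zero_and_padicValInt_le_of_not_dvd (hg₁C b₁ hb₁)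
  obtain ⟨h1₁, h2₁, hE₁⟩ := pairing 𝓛 hS (nonsplitTorus_fix 𝓛 hC) g₁ A₁ b₁ hA₁ hb₁
  have hβ₁ : 𝓛.B (𝓛.ρ g₁ wC) wS ≠ 0 := by
    intro h0; rw [h0, mul_zero] at h2₁; exact mul_ne_zero hb₁0 hBcc h2₁
  have hA₁0 : A₁ ≠ 0 := by
    intro h0; rw [h0, zero_mul] at h1₁
    exact mul_ne_zero (by exact_mod_cast hTspos) hβ₁ h1₁.symm
  have hA₁v : padicValNat 3 (q - 1) ≤ padicValInt 3 A₁ := le_padicValInt_of_dvd hA₁0 (hg₁S A₁ hA₁)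
  have hv₁ := congrArg (padicValInt 3) hE₁
  rw [padicValInt.mul (mul_ne_zero hA₁0 hBss) (by exact_mod_cast hTCpos),
    padicValInt.mul hA₁0 hBss, padicValInt.mul (mul_ne_zero hb₁0 hBcc) (by exact_mod_cast hTspos),
    padicValInt.mul hb₁0 hBcc, padicValInt.of_nat, padicValInt.of_nat] at hv₁
  omega

end Cases

/-! ### Composition: (F2a) `CubicTorusPeriodRatioAtThreeGeFive` from the five inputs, BY NAME (conditional theorem; the torus counts (T) are discharged by tree theorems) -/

/-- **S-K1′ on `q ≥ 5` from the five inputs (C1), (C2), (P1), (P2), (P3)** (CONDITIONAL: none of the five is proved here; the torus counts `|T_s|`, `|T_C|`, `3·|T_C³|` are the tree theorems `splitTorus_card`, `nonsplitTorus_card` (p681375), `nonsplitCubes_card` (p682001)). Concludes `CartanDegree.CubicTorusPeriodRatioAtThreeGeFive` (the tree decl of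
`Theorems/ClassRecordThreeEulerHalvesAtThreeCartanDegreeDefs.lean`, = stub (F2a) `stub_cubicTorusPeriodRatioAtThreeGeFive` of the
lead's `Lines/cartan.lean` v8) BY NAME. -/
theorem cubicTorusPeriodRatioAtThreeGeFive_of (hC1 : P_cuspCubeNormFixed) (hC2 : P_cuspGoodConjugate) (hP1 : P_psNonsplitNormLower) (hP2 : P_psSplitNormSharp)
    (hP3 : P_psNonsplitNormSharp) : CubicTorusPeriodRatioAtThreeGeFive := by
  intro q hq hq5 𝓛 wS wC hS hSgen hC hCgen
  haveI : Fact q.Prime := ⟨hq⟩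
  have hcard3 : 3 * (nonsplitCubes 𝓛.η).card = (q - 1) * (q + 1) := nonsplitCubes_card 𝓛.η_irred hq5
  have hcardS : (splitTorus q).card = (q - 1) ^ 2 := splitTorus_card
  have hcardC : (nonsplitTorus 𝓛.η).card = (q - 1) * (q + 1) := nonsplitTorus_card 𝓛.η_irred
  have h3 : q % 3 = 1 ∨ q % 3 = 2 := by
    have : ¬ 3 ∣ q := fun h => by
      have := (Nat.prime_dvd_prime_iff_eq Nat.prime_three hq).1 h
      omega
    omega
  rcases h3 with h1 | h2
  · exact ps_case 𝓛 hq5 hS hSgen hC hCgen hcardS hcardC (hP1 q hq5 h1 𝓛 wS wC hS hSgen hC hCgen)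
      (hP2 q hq5 h1 𝓛 wS wC hS hSgen hC hCgen) (hP3 q hq5 h1 𝓛 wS wC hS hSgen hC hCgen)
  · exact cusp_case 𝓛 hq5 hS hSgen hC hCgen hcardS hcard3 (hC1 q hq5 h2 𝓛) (hC2 q hq5 h2 𝓛.η 𝓛.η_irred)

end Summit.BirchSwinnertonDyer.BirchSwinnertonDyer.Theorems.CartanTorusCubeCut
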